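import Summits.NavierStokesRegularity.NavierStokesRegularity.Theorems.ExtremiserTransienceAxialMeanZeroHeatContraction
import Literature.Analysis.FluidPDE.TypeIAncientMild
import Literature.Analysis.FluidPDE.AncientMildDrift
import Literature.Analysis.FluidPDE.MildSolutionProofs
import Literature.Analysis.FluidPDE.KatoLocalBoundedPicard
import Literature.Analysis.FluidPDE.KNSSOseenMildDecayTools
import Literature.Analysis.FluidPDE.ForcedOseenMildPeriodic
import HarnessLib

/-!
# Route `ExtremiserTransience`, crux `NearExtremalTransiencePerFlow` (stmt-NavierStokesRegularity-26567), rung R1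
# `PeriodicFilamentLiouville` of LINE g9-β `filament_selection` — III: the axial average and ONE CONTRACTION STEP
# for the axial oscillation of a Type-I ancient mild solution

Theorems file (`--supports stmt-NavierStokesRegularity-26567`; theorems only, no definitions).  For a Type-I
ancient mild solution `W` in the Oseen (KNSS) gauge (`IsTypeIAncientMild C W`) whose slices are axially
`ℓ`-periodic, write `W̄(t)(x) = ℓ⁻¹ ∫₀^ℓ W(t)(x + s e_z) ds` (axial average; always written out, no definition)
and `W̃ = W − W̄` (axial oscillation: axially periodic with ZERO axial mean).

* §III: the axial average of a continuous bounded periodic slice — continuity, sup bound, invariance under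
  all axial translations, the oscillation has zero axial mean and is periodic.
* §IV `norm_axialOsc_le_step` — ONE CONTRACTION STEP: if `‖W‖ ≤ M` on `(t−h, t) × ℝ³` and `‖W̃‖ ≤ D` on
  `[t−h, t] × ℝ³` then `‖W̃(t, x)‖ ≤ θ(h,ℓ)·D + 8 C_B M √h · D`, where `θ(h,ℓ) < 1` is the heat-flow contraction
  factor of `norm_heatFlow_le_mul_of_axialMean_zero` (tools II) and `C_B` the constant of the bounded
  Oseen–Duhamel estimate `exists_norm_oseenDuhamel_le_mul`.  Mechanism: the mild identity
  `W(t) = e^{hΔ}W(t−h) − B(W,W)` between `t−h` and `t` AVERAGES (the axial line integral commutes with the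
  heat flow, `intervalIntegral_heatFlow_comp_add_smul`) to `W̄(t) = e^{hΔ}W̄(t−h) − avg B(W,W)`; bilinearity
  (`oseenDuhamel_sub_left/right`) splits `B(W,W) = B(W̃,W) + B(W̄,W̃) + B(W̄,W̄)` with `B(W̄,W̄)` axially invariant
  (`oseenDuhamel_comp_add_right`), so `W̃(t) = e^{hΔ}W̃(t−h) − (id − avg)[B(W̃,W) + B(W̄,W̃)]`, and the two
  Duhamel terms carry a factor `D·M·√h`.
No pressure, no energy identity, no Fourier series and no local-energy (linear-growth) hypothesis enter.
Sequel: `ExtremiserTransienceTypeIAncientAxiallyPeriodicLiouville` (iteration + Liouville).  Nothing here is a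
statement about Navier–Stokes regularity or blow-up; no summit is proved by a line. [folklore]

## Tree search

`IsTypeIAncientMild` API (`mild_eq`, `norm_le`, `continuous_slice`, `continuousOn_uncurry`,
`aestronglyMeasurable_uncurry`), `heatFlow_sub_of_bound`, `heatFlow_const_smul`, `continuous_uncurry_heatFlow`,
`oseenDuhamel_sub_left/right`, `oseenDuhamel_comp_add_right`, `oseenDuhamel_congr_of_eqOn_Ioo`,
`exists_norm_oseenDuhamel_le_mul` (all tree, Literature/Analysis/FluidPDE).
-/

noncomputable section

open MeasureTheory Set Function Filter Metric intervalIntegral Topology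
open Literature.Analysis Literature.Analysis.FluidPDE
open scoped RealInnerProductSpace ENNReal

namespace Summit.NavierStokesRegularity.NavierStokesRegularity.Theorems.AxiallyPeriodicLiouville
-- the summit's namespace `Summit.NavierStokesRegularity.NavierStokesRegularity` repeats the problem name by convention (D-0017)
set_option linter.dupNamespace false

/-! ## Part III — axially periodic Type-I ancient mild solutions: the axial average and oscillation -/

section AxialAverage

variable {F : Type*} [NormedAddCommGroup F] [NormedSpace ℝ F]

/-- The axial average `x ↦ ℓ⁻¹ ∫₀^ℓ f (x + s e_z) ds` of a continuous function is continuous. [folklore] -/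
theorem continuous_axialAvg {f : EuclideanSpace ℝ (Fin 3) → F} (hf : Continuous f) (ℓ : ℝ) :
    Continuous fun x : EuclideanSpace ℝ (Fin 3) => ℓ⁻¹ • ∫ s in (0 : ℝ)..ℓ, f (x + s • eZ) :=
  (continuous_intervalIntegral_comp_add_smul hf eZ 0 ℓ).const_smul _

/-- Sup bound of the axial average: `‖ℓ⁻¹ ∫₀^ℓ f (x + s e_z) ds‖ ≤ B` if `‖f‖ ≤ B`. [folklore] -/
theorem norm_axialAvg_le {f : EuclideanSpace ℝ (Fin 3) → F} {B ℓ : ℝ} (hℓ : 0 < ℓ) (hB : ∀ y, ‖f y‖ ≤ B)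
    (x : EuclideanSpace ℝ (Fin 3)) : ‖ℓ⁻¹ • ∫ s in (0 : ℝ)..ℓ, f (x + s • eZ)‖ ≤ B := by
  have h1 : ‖∫ s in (0 : ℝ)..ℓ, f (x + s • eZ)‖ ≤ B * |ℓ - 0| :=
    intervalIntegral.norm_integral_le_of_norm_le_const fun s _ => hB _
  rw [sub_zero, abs_of_pos hℓ] at h1
  rw [norm_smul, norm_inv, Real.norm_of_nonneg hℓ.le]
  calc ℓ⁻¹ * ‖∫ s in (0 : ℝ)..ℓ, f (x + s • eZ)‖ ≤ ℓ⁻¹ * (B * ℓ) := by gcongr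
    _ = B := by field_simp

/-- The axial average of an axially `ℓ`-periodic function is invariant under ALL axial translations.
[folklore] -/
theorem axialAvg_add_smul_eZ {f : EuclideanSpace ℝ (Fin 3) → F} {ℓ : ℝ} (hf : IsAxiallyPeriodic ℓ f)
    (x : EuclideanSpace ℝ (Fin 3)) (σ : ℝ) :
    ℓ⁻¹ • ∫ s in (0 : ℝ)..ℓ, f (x + σ • eZ + s • eZ) = ℓ⁻¹ • ∫ s in (0 : ℝ)..ℓ, f (x + s • eZ) := by
  congr 1
  have h1 : ∫ s in (0 : ℝ)..ℓ, f (x + σ • eZ + s • eZ) = ∫ s in (0 : ℝ)..ℓ, (fun r => f (x + r • eZ)) (s + σ) := by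
    refine intervalIntegral.integral_congr fun s _ => ?_
    simp only [add_smul, add_assoc, add_comm (σ • eZ)]
  rw [h1, intervalIntegral.integral_comp_add_right (fun r => f (x + r • eZ)) σ, zero_add, add_comm ℓ σ]
  have h2 := (isAxiallyPeriodic_periodic_line hf x).intervalIntegral_add_eq σ 0
  rw [zero_add] at h2
  exact h2

/-- The axial average of an axially invariant function is the function itself. [folklore] -/
theorem axialAvg_of_invariant [CompleteSpace F] {f : EuclideanSpace ℝ (Fin 3) → F} {ℓ : ℝ} (hℓ : 0 < ℓ)
    {x : EuclideanSpace ℝ (Fin 3)} (hf : ∀ s : ℝ, f (x + s • eZ) = f x) :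
    ℓ⁻¹ • ∫ s in (0 : ℝ)..ℓ, f (x + s • eZ) = f x := by
  simp only [hf, intervalIntegral.integral_const, sub_zero]
  rw [smul_smul, inv_mul_cancel₀ hℓ.ne', one_smul]

/-- The oscillation `f − (axial average of f)` of a continuous axially `ℓ`-periodic function has zero axial mean.
[folklore] -/
theorem axialMean_sub_axialAvg_eq_zero [CompleteSpace F] {f : EuclideanSpace ℝ (Fin 3) → F} {ℓ : ℝ} (hℓ : 0 < ℓ) (hfc : Continuous f)
    (hf : IsAxiallyPeriodic ℓ f) (x : EuclideanSpace ℝ (Fin 3)) :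
    ∫ s in (0 : ℝ)..ℓ, (f (x + s • eZ) - ℓ⁻¹ • ∫ r in (0 : ℝ)..ℓ, f (x + s • eZ + r • eZ)) = 0 := by
  simp only [axialAvg_add_smul_eZ hf]
  have hint : IntervalIntegrable (fun s : ℝ => f (x + s • eZ)) volume 0 ℓ := by
    refine Continuous.intervalIntegrable ?_ _ _
    exact hfc.comp (by fun_prop)
  rw [intervalIntegral.integral_sub hint intervalIntegrable_const, intervalIntegral.integral_const, sub_zero,
    smul_smul, mul_inv_cancel₀ hℓ.ne', one_smul, sub_self]

/-- The oscillation of an axially `ℓ`-periodic function is axially `ℓ`-periodic. [folklore] -/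
theorem isAxiallyPeriodic_sub_axialAvg [CompleteSpace F] {f : EuclideanSpace ℝ (Fin 3) → F} {ℓ : ℝ} (hf : IsAxiallyPeriodic ℓ f) :
    IsAxiallyPeriodic ℓ fun x => f x - ℓ⁻¹ • ∫ s in (0 : ℝ)..ℓ, f (x + s • eZ) := by
  intro x
  have h1 := hf x
  have h2 := axialAvg_add_smul_eZ hf x ℓ
  simp only [eZ] at h1 h2 ⊢
  rw [h1, h2]

end AxialAverage


/-! ## Part IV — one contraction step for the axial oscillation of a Type-I ancient mild solution -/

section Step

/-- **One contraction step.** Let `W` be a Type-I ancient mild solution (Oseen gauge) with axially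
`ℓ`-periodic slices, `h > 0`, `t < 0`; write `W̄(τ) = ` axial average of `W(τ)`, `W̃ = W − W̄`.  If
`‖W‖ ≤ M` on `(t−h, t) × ℝ³` and `‖W̃‖ ≤ D` on `[t−h, t] × ℝ³`, then
`‖W̃(t, x)‖ ≤ θ(h, ℓ)·D + 8 C_B M √h · D` for every `x`, where `θ(h, ℓ) < 1` is the contraction factor of
`norm_heatFlow_le_mul_of_axialMean_zero` and `C_B` the constant of the bounded Oseen–Duhamel estimate
(`‖B¹_s(u,v)(t)‖ ≤ C_B ‖u‖_∞ ‖v‖_∞ · 2√(t−s)`, the tree's `exists_norm_oseenDuhamel_le_mul`).  Mechanism: the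
mild identity `W(t) = e^{hΔ}W(t−h) − B(W,W)` averages to `W̄(t) = e^{hΔ}W̄(t−h) − avg B(W,W)` (the line integral
commutes with the heat flow), so `W̃(t) = e^{hΔ}W̃(t−h) − (id − avg)[B(W̃,W) + B(W̄,W̃)]`, the term
`B(W̄,W̄)` being axially invariant. [folklore] -/
theorem norm_axialOsc_le_step
    {W : ℝ → EuclideanSpace ℝ (Fin 3) → EuclideanSpace ℝ (Fin 3)} {C ℓ : ℝ} (hW : IsTypeIAncientMild C W)
    (hℓ : 0 < ℓ) (hper : ∀ t < 0, IsAxiallyPeriodic ℓ (W t))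
    {Cₒ : ℝ} (hCₒ : ∀ (u v : ℝ → EuclideanSpace ℝ (Fin 3) → EuclideanSpace ℝ (Fin 3)) (s t Mu Mv : ℝ),
        s < t → 0 ≤ Mu → 0 ≤ Mv →
        (∀ τ ∈ Ioo s t, ∀ y, ‖u τ y‖ ≤ Mu) → (∀ τ ∈ Ioo s t, ∀ y, ‖v τ y‖ ≤ Mv) →
        ∀ x, ‖oseenDuhamel 1 s u v t x‖ ≤ Cₒ * Mu * Mv * (2 * Real.sqrt (t - s)))
    {h : ℝ} (hh : 0 < h) {t : ℝ} (ht : t < 0) {M D : ℝ} (hM : 0 ≤ M) (hD : 0 ≤ D)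
    (hMW : ∀ τ ∈ Ioo (t - h) t, ∀ y, ‖W τ y‖ ≤ M)
    (hDosc : ∀ τ ∈ Icc (t - h) t, ∀ y, ‖W τ y - ℓ⁻¹ • ∫ r in (0 : ℝ)..ℓ, W τ (y + r • eZ)‖ ≤ D)
    (x : EuclideanSpace ℝ (Fin 3)) :
    ‖W t x - ℓ⁻¹ • ∫ r in (0 : ℝ)..ℓ, W t (x + r • eZ)‖ ≤
      (1 - (4 * Real.pi * h) ^ (-(3 : ℝ) / 2) * Real.exp (-(ℓ ^ 2 / (8 * h))) *
          (volume (Metric.ball (0 : EuclideanSpace ℝ (Fin 3)) (ℓ / 2))).toReal) * D +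
        8 * Cₒ * M * Real.sqrt h * D := by
  -- ### notation
  set s : ℝ := t - h with hs_def
  have hst : s < t := by rw [hs_def]; linarith
  have hs0 : s < 0 := hst.trans ht
  have hts : t - s = h := by rw [hs_def]; ring
  set avg : ℝ → EuclideanSpace ℝ (Fin 3) → EuclideanSpace ℝ (Fin 3) :=
    fun τ y => ℓ⁻¹ • ∫ r in (0 : ℝ)..ℓ, W τ (y + r • eZ) with havg
  set osc : ℝ → EuclideanSpace ℝ (Fin 3) → EuclideanSpace ℝ (Fin 3) := fun τ y => W τ y - avg τ y with hosc
  -- ### slices: continuity, bounds, periodicity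
  have hWc : ∀ τ < 0, Continuous (W τ) := fun τ hτ => hW.continuous_slice hτ
  have havgc : ∀ τ < 0, Continuous (avg τ) := fun τ hτ => continuous_axialAvg (hWc τ hτ) ℓ
  have hoscc : ∀ τ < 0, Continuous (osc τ) := fun τ hτ => (hWc τ hτ).sub (havgc τ hτ)
  have hMavg : ∀ τ ∈ Ioo s t, ∀ y, ‖avg τ y‖ ≤ M := fun τ hτ y => norm_axialAvg_le hℓ (hMW τ hτ) y
  have hDosc' : ∀ τ ∈ Ioo s t, ∀ y, ‖osc τ y‖ ≤ D := fun τ hτ y => hDosc τ (Ioo_subset_Icc_self hτ) y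
  have havg_inv : ∀ τ < 0, ∀ (y : EuclideanSpace ℝ (Fin 3)) (σ : ℝ), avg τ (y + σ • eZ) = avg τ y :=
    fun τ hτ y σ => axialAvg_add_smul_eZ (hper τ hτ) y σ
  -- ### measurability on the slab `(s, t) × ℝ³`
  have hslab : MeasurableSet (Ioo s t ×ˢ (univ : Set (EuclideanSpace ℝ (Fin 3)))) :=
    measurableSet_Ioo.prod MeasurableSet.univ
  have hsub : Ioo s t ×ˢ (univ : Set (EuclideanSpace ℝ (Fin 3))) ⊆ Iio 0 ×ˢ univ :=
    prod_mono (fun τ hτ => hτ.2.trans ht) le_rfl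
  have hWm : AEStronglyMeasurable (uncurry W)
      ((volume : Measure (ℝ × EuclideanSpace ℝ (Fin 3))).restrict (Ioo s t ×ˢ univ)) :=
    hW.aestronglyMeasurable_uncurry ht.le
  have havg_on : ContinuousOn (uncurry avg) (Iio 0 ×ˢ (univ : Set (EuclideanSpace ℝ (Fin 3)))) := by
    have h1 := continuousOn_intervalIntegral_comp_add_smul isOpen_Iio hW.continuousOn_uncurry eZ 0 ℓ
    have h2 := h1.const_smul ℓ⁻¹
    refine h2.congr fun p _ => ?_
    simp only [havg, uncurry, Pi.smul_apply]
  have havgm : AEStronglyMeasurable (uncurry avg)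
      ((volume : Measure (ℝ × EuclideanSpace ℝ (Fin 3))).restrict (Ioo s t ×ˢ univ)) :=
    (havg_on.mono hsub).aestronglyMeasurable hslab
  have hoscm : AEStronglyMeasurable (uncurry osc)
      ((volume : Measure (ℝ × EuclideanSpace ℝ (Fin 3))).restrict (Ioo s t ×ˢ univ)) := by
    have := hWm.sub havgm
    exact this
  -- ### the mild identity between `s` and `t`, and the Duhamel term
  set Bf : EuclideanSpace ℝ (Fin 3) → EuclideanSpace ℝ (Fin 3) := fun y => oseenDuhamel 1 s W W t y with hBf
  have hmild : ∀ y, W t y = heatFlow (W s) h y - Bf y := by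
    intro y
    have := hW.mild_eq hst ht y
    rwa [hts] at this
  have hheat_c : Continuous fun y => heatFlow (W s) h y := by
    have hb : ∀ z, ‖W s z‖ ≤ C / Real.sqrt (-s) := fun z => hW.norm_le hs0 z
    exact (continuous_uncurry_heatFlow (hWc s hs0) hb).comp (Continuous.prodMk_right h)
  have hBf_c : Continuous Bf := by
    have : Bf = fun y => heatFlow (W s) h y - W t y := by
      funext y; rw [hmild y]; abel
    rw [this]
    exact hheat_c.sub (hWc t ht)
  -- decomposition `B(W,W) = B(osc,W) + B(avg,osc) + B(avg,avg)`
  have hdec : ∀ y, Bf y = oseenDuhamel 1 s osc W t y + oseenDuhamel 1 s avg osc t y +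
      oseenDuhamel 1 s avg avg t y := by
    intro y
    have h1 : oseenDuhamel 1 s osc W t y = oseenDuhamel 1 s W W t y - oseenDuhamel 1 s avg W t y :=
      oseenDuhamel_sub_left one_pos hWm havgm hWm hMW hMavg hMW hst le_rfl y
    have h2 : oseenDuhamel 1 s avg osc t y = oseenDuhamel 1 s avg W t y - oseenDuhamel 1 s avg avg t y :=
      oseenDuhamel_sub_right one_pos havgm hWm havgm hMavg hMW hMavg hst le_rfl y
    rw [h1, h2]
    abel
  -- `B(avg, avg)` is axially invariant
  have hI_inv : ∀ (y : EuclideanSpace ℝ (Fin 3)) (σ : ℝ),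
      oseenDuhamel 1 s avg avg t (y + σ • eZ) = oseenDuhamel 1 s avg avg t y := by
    intro y σ
    rw [← oseenDuhamel_comp_add_right 1 s avg avg (σ • eZ) t y]
    refine oseenDuhamel_congr_of_eqOn_Ioo (fun τ hτ => ?_) (fun τ hτ => ?_) y <;>
      exact funext fun z => havg_inv τ (hτ.2.trans ht) z σ
  -- the small part and its bound
  set Dsm : EuclideanSpace ℝ (Fin 3) → EuclideanSpace ℝ (Fin 3) :=
    fun y => oseenDuhamel 1 s osc W t y + oseenDuhamel 1 s avg osc t y with hDsm
  have hδ : ∀ y, ‖Dsm y‖ ≤ 4 * Cₒ * M * Real.sqrt h * D := by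
    intro y
    have h1 := hCₒ osc W s t D M hst hD hM hDosc' hMW y
    have h2 := hCₒ avg osc s t M D hst hM hD hMavg hDosc' y
    rw [hts] at h1 h2
    calc ‖Dsm y‖ ≤ ‖oseenDuhamel 1 s osc W t y‖ + ‖oseenDuhamel 1 s avg osc t y‖ := norm_add_le _ _
      _ ≤ Cₒ * D * M * (2 * Real.sqrt h) + Cₒ * M * D * (2 * Real.sqrt h) := add_le_add h1 h2
      _ = 4 * Cₒ * M * Real.sqrt h * D := by ring
  have hBf_eq : ∀ y, Bf y = Dsm y + oseenDuhamel 1 s avg avg t y := fun y => by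
    rw [hdec y]
  -- ### the averaged mild identity
  have hline_c : Continuous fun σ : ℝ => Bf (x + σ • eZ) := hBf_c.comp (by fun_prop)
  have hheat_line_c : Continuous fun σ : ℝ => heatFlow (W s) h (x + σ • eZ) := hheat_c.comp (by fun_prop)
  have hWs_bd : ∀ z, ‖W s z‖ ≤ C / Real.sqrt (-s) := fun z => hW.norm_le hs0 z
  have havg_t : avg t x = heatFlow (avg s) h x - ℓ⁻¹ • ∫ σ in (0 : ℝ)..ℓ, Bf (x + σ • eZ) := by
    have h1 : ∫ σ in (0 : ℝ)..ℓ, W t (x + σ • eZ) =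
        ∫ σ in (0 : ℝ)..ℓ, (heatFlow (W s) h (x + σ • eZ) - Bf (x + σ • eZ)) :=
      intervalIntegral.integral_congr fun σ _ => hmild _
    have h2 : ∫ σ in (0 : ℝ)..ℓ, (heatFlow (W s) h (x + σ • eZ) - Bf (x + σ • eZ)) =
        (∫ σ in (0 : ℝ)..ℓ, heatFlow (W s) h (x + σ • eZ)) - ∫ σ in (0 : ℝ)..ℓ, Bf (x + σ • eZ) :=
      intervalIntegral.integral_sub (hheat_line_c.intervalIntegrable _ _) (hline_c.intervalIntegrable _ _)
    have h3 : ∫ σ in (0 : ℝ)..ℓ, heatFlow (W s) h (x + σ • eZ) =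
        heatFlow (fun z => ∫ σ in (0 : ℝ)..ℓ, W s (z + σ • eZ)) h x :=
      intervalIntegral_heatFlow_comp_add_smul (hWc s hs0) hWs_bd h x eZ hℓ.le
    have h4 : heatFlow (avg s) h x = ℓ⁻¹ • heatFlow (fun z => ∫ σ in (0 : ℝ)..ℓ, W s (z + σ • eZ)) h x := by
      rw [← heatFlow_const_smul]
    show ℓ⁻¹ • ∫ σ in (0 : ℝ)..ℓ, W t (x + σ • eZ) = _
    rw [h1, h2, h3, h4, smul_sub]
  -- ### the oscillation identity `W̃(t) = e^{hΔ} W̃(s) − (id − avg) B(W,W)`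
  have hosc_t : osc t x = heatFlow (osc s) h x - (Bf x - ℓ⁻¹ • ∫ σ in (0 : ℝ)..ℓ, Bf (x + σ • eZ)) := by
    have hsplit : heatFlow (osc s) h x = heatFlow (W s) h x - heatFlow (avg s) h x :=
      heatFlow_sub_of_bound (hWc s hs0) (havgc s hs0) hWs_bd (fun y => norm_axialAvg_le hℓ hWs_bd y) h x
    show W t x - avg t x = _
    rw [hsplit, hmild x, havg_t]
    abel
  -- ### contraction of the heat part
  have hs_mem : s ∈ Icc (t - h) t := ⟨le_rfl, hst.le⟩
  have hθ : ‖heatFlow (osc s) h x‖ ≤ (1 - (4 * Real.pi * h) ^ (-(3 : ℝ) / 2) * Real.exp (-(ℓ ^ 2 / (8 * h))) *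
      (volume (Metric.ball (0 : EuclideanSpace ℝ (Fin 3)) (ℓ / 2))).toReal) * D :=
    norm_heatFlow_le_mul_of_axialMean_zero hℓ hh (hoscc s hs0) (fun y => hDosc s hs_mem y)
      (isAxiallyPeriodic_sub_axialAvg (hper s hs0))
      (fun y => axialMean_sub_axialAvg_eq_zero hℓ (hWc s hs0) (hper s hs0) y) x
  -- ### the remainder `(id − avg)[B(W̃,W) + B(W̄,W̃)]`
  have hrem : ‖Bf x - ℓ⁻¹ • ∫ σ in (0 : ℝ)..ℓ, Bf (x + σ • eZ)‖ ≤ 2 * (4 * Cₒ * M * Real.sqrt h * D) := by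
    have hline : ∀ σ : ℝ, Bf (x + σ • eZ) = Dsm (x + σ • eZ) + oseenDuhamel 1 s avg avg t x := by
      intro σ
      rw [hBf_eq, hI_inv]
    have hDl : (fun σ : ℝ => Dsm (x + σ • eZ)) = fun σ => Bf (x + σ • eZ) - oseenDuhamel 1 s avg avg t x := by
      funext σ
      rw [hline σ, add_sub_cancel_right]
    have hDl_int : IntervalIntegrable (fun σ : ℝ => Dsm (x + σ • eZ)) volume 0 ℓ := by
      rw [hDl]
      exact (hline_c.sub continuous_const).intervalIntegrable _ _
    have hid : Bf x - ℓ⁻¹ • ∫ σ in (0 : ℝ)..ℓ, Bf (x + σ • eZ) =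
        Dsm x - ℓ⁻¹ • ∫ σ in (0 : ℝ)..ℓ, Dsm (x + σ • eZ) := by
      rw [intervalIntegral.integral_congr fun σ _ => hline σ,
        intervalIntegral.integral_add hDl_int intervalIntegrable_const, intervalIntegral.integral_const, sub_zero,
        hBf_eq x, smul_add, smul_smul, inv_mul_cancel₀ hℓ.ne', one_smul]
      abel
    rw [hid]
    calc ‖Dsm x - ℓ⁻¹ • ∫ σ in (0 : ℝ)..ℓ, Dsm (x + σ • eZ)‖
        ≤ ‖Dsm x‖ + ‖ℓ⁻¹ • ∫ σ in (0 : ℝ)..ℓ, Dsm (x + σ • eZ)‖ := norm_sub_le _ _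
      _ ≤ 4 * Cₒ * M * Real.sqrt h * D + 4 * Cₒ * M * Real.sqrt h * D :=
          add_le_add (hδ x) (norm_axialAvg_le hℓ hδ x)
      _ = 2 * (4 * Cₒ * M * Real.sqrt h * D) := by ring
  -- ### conclusion
  show ‖osc t x‖ ≤ _
  rw [hosc_t]
  calc ‖heatFlow (osc s) h x - (Bf x - ℓ⁻¹ • ∫ σ in (0 : ℝ)..ℓ, Bf (x + σ • eZ))‖
      ≤ ‖heatFlow (osc s) h x‖ + ‖Bf x - ℓ⁻¹ • ∫ σ in (0 : ℝ)..ℓ, Bf (x + σ • eZ)‖ := norm_sub_le _ _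
    _ ≤ (1 - (4 * Real.pi * h) ^ (-(3 : ℝ) / 2) * Real.exp (-(ℓ ^ 2 / (8 * h))) *
          (volume (Metric.ball (0 : EuclideanSpace ℝ (Fin 3)) (ℓ / 2))).toReal) * D +
        2 * (4 * Cₒ * M * Real.sqrt h * D) := add_le_add hθ hrem
    _ = _ := by ring

end Step

end Summit.NavierStokesRegularity.NavierStokesRegularity.Theorems.AxiallyPeriodicLiouville

end
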